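import Summits.CriticalPhenomena.PercolationContinuityZ3.Theorems.PercNearOneGluingNoHeavyLowerTailCubicThreePointSections
import Literature.Probability.Percolation.LocalIsoTransport
import HarnessLib

/-!
# `NoHeavyLowerTail` (stmt-CriticalPhenomena-4575) — vertex relabelling in the finitary weighted calculus:
# the three-point cells `PrW D p (ev… K a b c)` are invariant under any vertex map injective on the support

Support file (prover prim-gen-kcluster gen 25, k-cluster / sharp-cubic-row line; `--supports stmt-CriticalPhenomena-4575`).  No definitions,
no named facts, no sorries.  TRANSPORT LEMMA for the calculus of `…CubicThreePointSections` (random open edges `S ⊆ D` with weights `p`,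
forced edges `K`, reachability `R K S`, cells `evQ, evU₁, evU₂, evU₃, evT`, masses `PrW`): a vertex map `f : V → W` that is injective on a
vertex set `U` carrying every edge of `D ∪ K` and the terminals `a, b, c` transports configurations edge by edge (`S ↦ S.image (Sym2.map f)`),
preserves reachability between vertices of `U` in both directions (`R_image_iff`: a walk in the image graph lifts step by step because
consecutive image edges share an image vertex, whose preimage in `U` is unique), hence the five cells (`image_mem_ev*_iff`), the Bernoulli
weights (`wtW_image`) and the masses (`PrW_image`, `PrW_image_evQ/…/T`) for any weight `p'` on `W` with `p' (Sym2.map f e) = p e` on `D`.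
Use (`…CubicThreePointSharpRowLocal`): every piece of a graph supported on five vertices is relabelled INTO `Fin 5`, where the sharp cubic row
is a theorem for all weights (`ThetaCells.maxH_univ_fin5_nonneg`, gen 24) — the map need only be injective on the five support vertices, so no
cardinality hypothesis on `V` arises.  Tree anchor for `Sym2.map` on pairs of an injectivity set: `injOn_sym2Map_of_injOn` (`LocalIsoTransport`).
[cite: Grimmett1999, §2.2 (product measure; events of finitely many edges)]
-/

noncomputable section

namespace Summit.CriticalPhenomena.PercolationContinuityZ3.Theorems

namespace VertexRelabel

open Finset SimpleGraph Literature.Probability.Percolation Literature.Probability.Percolation.DecisionTree CubicThreePointStep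

variable {V W : Type*} [DecidableEq V] [DecidableEq W] (f : V → W) {U : Finset V}

/-! ### Injectivity on edges -/

omit [DecidableEq V] [DecidableEq W] in
/-- `Sym2.map f` is injective on any edge set carried by a vertex set on which `f` is injective. [folklore] -/
theorem sym2Map_injOn (hf : Set.InjOn f ↑U) {E : Finset (Sym2 V)} (hE : ∀ e ∈ E, ∀ v ∈ e, v ∈ U) :
    Set.InjOn (Sym2.map f) ↑E := by
  refine (injOn_sym2Map_of_injOn f hf).mono fun e he => ?_
  induction e using Sym2.ind with
  | h x y =>
    rw [Set.mk_mem_sym2_iff]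
    exact ⟨hE _ he x (Sym2.mem_mk_left x y), hE _ he y (Sym2.mem_mk_right x y)⟩

omit [DecidableEq V] in
/-- For `S ⊆ D` and `e ∈ D`: `Sym2.map f e ∈ S.image (Sym2.map f) ↔ e ∈ S`. [folklore] -/
theorem map_mem_image_iff {D S : Finset (Sym2 V)} (hF : Set.InjOn (Sym2.map f) ↑D) (hS : S ⊆ D) {e : Sym2 V} (he : e ∈ D) :
    Sym2.map f e ∈ S.image (Sym2.map f) ↔ e ∈ S := by
  refine ⟨fun h => ?_, fun h => Finset.mem_image_of_mem _ h⟩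
  obtain ⟨e₁, he₁, hfe⟩ := Finset.mem_image.1 h
  rwa [← hF (hS he₁) he hfe]

/-! ### Reachability -/

omit [DecidableEq V] in
/-- One step of the lift: an image edge at an image vertex `f y`, `y ∈ U`, comes from an edge of `E` at `y`. [folklore] -/
theorem adj_lift (hf : Set.InjOn f ↑U) {E : Finset (Sym2 V)} (hE : ∀ e ∈ E, ∀ v ∈ e, v ∈ U) {y : V} (hy : y ∈ U) {z' : W}
    (h : (fromEdgeSet (↑(E.image (Sym2.map f)) : Set (Sym2 W))).Adj (f y) z') :
    ∃ z ∈ U, f z = z' ∧ (fromEdgeSet (↑E : Set (Sym2 V))).Adj y z := by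
  rw [fromEdgeSet_adj, Finset.mem_coe, Finset.mem_image] at h
  obtain ⟨⟨e, he, hfe⟩, hne⟩ := h
  revert he hfe
  refine Sym2.ind (fun u v => ?_) e
  intro he hfe
  rw [Sym2.map_mk, Sym2.eq_iff] at hfe
  have hu := hE _ he u (Sym2.mem_mk_left u v)
  have hv := hE _ he v (Sym2.mem_mk_right u v)
  rcases hfe with ⟨h1, h2⟩ | ⟨h1, h2⟩
  · have huy : u = y := hf hu hy h1
    subst huy
    refine ⟨v, hv, h2, ?_⟩
    rw [fromEdgeSet_adj, Finset.mem_coe]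
    exact ⟨he, fun huv => hne (by rw [← h2, huv])⟩
  · have hvy : v = y := hf hv hy h2
    subst hvy
    refine ⟨u, hu, h1, ?_⟩
    rw [fromEdgeSet_adj, Finset.mem_coe, Sym2.eq_swap]
    exact ⟨he, fun hvu => hne (by rw [← h1, hvu])⟩

/-- Forward transport of reachability: a walk of `S ∪ K` maps to a walk of the image edges. [folklore] -/
theorem R_image (hf : Set.InjOn f ↑U) {K S : Finset (Sym2 V)} (hE : ∀ e ∈ S ∪ K, ∀ v ∈ e, v ∈ U) {x y : V} (h : R K S x y) :
    R (K.image (Sym2.map f)) (S.image (Sym2.map f)) (f x) (f y) := by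
  unfold R at h ⊢
  rw [← Finset.image_union]
  rw [reachable_iff_reflTransGen] at h ⊢
  induction h with
  | refl => exact Relation.ReflTransGen.refl
  | tail _ hadj ih =>
    refine ih.tail ?_
    rw [fromEdgeSet_adj, Finset.mem_coe] at hadj ⊢
    obtain ⟨hmem, hne⟩ := hadj
    refine ⟨Finset.mem_image.2 ⟨_, hmem, Sym2.map_mk _ _ _⟩, fun hfe => hne (hf ?_ ?_ hfe)⟩
    · exact hE _ hmem _ (Sym2.mem_mk_left _ _)
    · exact hE _ hmem _ (Sym2.mem_mk_right _ _)

/-- Backward transport of reachability between vertices of `U`: a walk of image edges starting at `f x` stays on image vertices and lifts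
step by step (`adj_lift`). [folklore] -/
theorem R_of_R_image (hf : Set.InjOn f ↑U) {K S : Finset (Sym2 V)} (hE : ∀ e ∈ S ∪ K, ∀ v ∈ e, v ∈ U) {x y : V} (hx : x ∈ U)
    (hy : y ∈ U) (h : R (K.image (Sym2.map f)) (S.image (Sym2.map f)) (f x) (f y)) : R K S x y := by
  unfold R at h ⊢
  rw [← Finset.image_union] at h
  rw [reachable_iff_reflTransGen] at h ⊢
  suffices H : ∀ y', Relation.ReflTransGen (fromEdgeSet (↑((S ∪ K).image (Sym2.map f)) : Set (Sym2 W))).Adj (f x) y' →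
      ∃ y₀ ∈ U, f y₀ = y' ∧ Relation.ReflTransGen (fromEdgeSet (↑(S ∪ K) : Set (Sym2 V))).Adj x y₀ by
    obtain ⟨y₀, hy₀, hfy, hr⟩ := H _ h
    rwa [← hf hy₀ hy hfy]
  intro y' h'
  induction h' with
  | refl => exact ⟨x, hx, rfl, Relation.ReflTransGen.refl⟩
  | tail _ hadj ih =>
    obtain ⟨y₀, hy₀U, hfy₀, hr⟩ := ih
    rw [← hfy₀] at hadj
    obtain ⟨z, hzU, hfz, hadj'⟩ := adj_lift f hf hE hy₀U hadj
    exact ⟨z, hzU, hfz, hr.tail hadj'⟩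

/-- **Reachability is invariant under relabelling** (between vertices of the injectivity set `U` carrying all edges). [folklore] -/
theorem R_image_iff (hf : Set.InjOn f ↑U) {K S : Finset (Sym2 V)} (hE : ∀ e ∈ S ∪ K, ∀ v ∈ e, v ∈ U) {x y : V} (hx : x ∈ U)
    (hy : y ∈ U) : R (K.image (Sym2.map f)) (S.image (Sym2.map f)) (f x) (f y) ↔ R K S x y :=
  ⟨R_of_R_image f hf hE hx hy, R_image f hf hE⟩

/-! ### The five cells -/

section Cells

variable (hf : Set.InjOn f ↑U) {D K : Finset (Sym2 V)} (hE : ∀ e ∈ D ∪ K, ∀ v ∈ e, v ∈ U) {a b c : V} (ha : a ∈ U) (hb : b ∈ U)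
  (hc : c ∈ U)
include hf hE

omit hf in
/-- Edges of a sub-configuration `S ⊆ D` (plus `K`) lie in `U`. [folklore] -/
theorem edges_sub {S : Finset (Sym2 V)} (hS : S ⊆ D) : ∀ e ∈ S ∪ K, ∀ v ∈ e, v ∈ U := fun e he =>
  hE e (Finset.union_subset_union hS le_rfl he)

include ha hb hc

/-- Transport of the cell `abc`. [folklore] -/
theorem image_mem_evT_iff {S : Finset (Sym2 V)} (hS : S ⊆ D) :
    S.image (Sym2.map f) ∈ evT (K.image (Sym2.map f)) (f a) (f b) (f c) ↔ S ∈ evT K a b c := by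
  simp only [mem_evT, R_image_iff f hf (edges_sub hE hS) ha hb, R_image_iff f hf (edges_sub hE hS) ha hc]

/-- Transport of the cell `ab|c`. [folklore] -/
theorem image_mem_evU₁_iff {S : Finset (Sym2 V)} (hS : S ⊆ D) :
    S.image (Sym2.map f) ∈ evU₁ (K.image (Sym2.map f)) (f a) (f b) (f c) ↔ S ∈ evU₁ K a b c := by
  simp only [mem_evU₁, R_image_iff f hf (edges_sub hE hS) ha hb, R_image_iff f hf (edges_sub hE hS) ha hc]

/-- Transport of the cell `ac|b`. [folklore] -/
theorem image_mem_evU₂_iff {S : Finset (Sym2 V)} (hS : S ⊆ D) :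
    S.image (Sym2.map f) ∈ evU₂ (K.image (Sym2.map f)) (f a) (f b) (f c) ↔ S ∈ evU₂ K a b c := by
  simp only [mem_evU₂, R_image_iff f hf (edges_sub hE hS) ha hb, R_image_iff f hf (edges_sub hE hS) ha hc]

/-- Transport of the cell `bc|a`. [folklore] -/
theorem image_mem_evU₃_iff {S : Finset (Sym2 V)} (hS : S ⊆ D) :
    S.image (Sym2.map f) ∈ evU₃ (K.image (Sym2.map f)) (f a) (f b) (f c) ↔ S ∈ evU₃ K a b c := by
  simp only [mem_evU₃, R_image_iff f hf (edges_sub hE hS) hb hc, R_image_iff f hf (edges_sub hE hS) ha hb]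

/-- Transport of the cell `a|b|c`. [folklore] -/
theorem image_mem_evQ_iff {S : Finset (Sym2 V)} (hS : S ⊆ D) :
    S.image (Sym2.map f) ∈ evQ (K.image (Sym2.map f)) (f a) (f b) (f c) ↔ S ∈ evQ K a b c := by
  simp only [mem_evQ, R_image_iff f hf (edges_sub hE hS) ha hb, R_image_iff f hf (edges_sub hE hS) ha hc,
    R_image_iff f hf (edges_sub hE hS) hb hc]

end Cells

/-! ### Weights and masses -/

section Mass

variable {D : Finset (Sym2 V)} (hF : Set.InjOn (Sym2.map f) ↑D) {p : Sym2 V → ℝ} {p' : Sym2 W → ℝ}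
  (hp : ∀ e ∈ D, p' (Sym2.map f e) = p e)
include hF hp

/-- Transport of the Bernoulli weight of a configuration `S ⊆ D`. [folklore] -/
theorem wtW_image {S : Finset (Sym2 V)} (hS : S ⊆ D) : wtW (D.image (Sym2.map f)) p' (S.image (Sym2.map f)) = wtW D p S := by
  unfold wtW
  rw [Finset.prod_image hF]
  refine Finset.prod_congr rfl fun e he => ?_
  simp only [map_mem_image_iff f hF hS he, hp e he]

/-- **Transport of masses.**  If the events `X` on `V` and `X'` on `W` correspond under `S ↦ S.image (Sym2.map f)` for `S ⊆ D`, then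
`PrW (D.image (Sym2.map f)) p' X' = PrW D p X` (reindex the sum over configurations; weights by `wtW_image`). [folklore] -/
theorem PrW_image {X : Set (Finset (Sym2 V))} {X' : Set (Finset (Sym2 W))} (hX : ∀ S, S ⊆ D → (S.image (Sym2.map f) ∈ X' ↔ S ∈ X)) :
    PrW (D.image (Sym2.map f)) p' X' = PrW D p X := by
  unfold PrW
  symm
  refine Finset.sum_nbij' (fun S => S.image (Sym2.map f)) (fun S' => D.filter (fun e => Sym2.map f e ∈ S')) ?_ ?_ ?_ ?_ ?_
  · intro S hS
    rw [Finset.mem_powerset] at hS ⊢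
    exact Finset.image_subset_image hS
  · intro S' _
    rw [Finset.mem_powerset]
    exact Finset.filter_subset _ _
  · intro S hS
    rw [Finset.mem_powerset] at hS
    ext e
    simp only [Finset.mem_filter]
    refine ⟨fun h => (map_mem_image_iff f hF hS h.1).1 h.2, fun he => ⟨hS he, Finset.mem_image_of_mem _ he⟩⟩
  · intro S' hS'
    rw [Finset.mem_powerset] at hS'
    ext e'
    simp only [Finset.mem_image, Finset.mem_filter]
    refine ⟨?_, fun he' => ?_⟩
    · rintro ⟨e, ⟨_, he'⟩, rfl⟩
      exact he'
    · obtain ⟨e, he, rfl⟩ := Finset.mem_image.1 (hS' he')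
      exact ⟨e, ⟨he, he'⟩, rfl⟩
  · intro S hS
    rw [Finset.mem_powerset] at hS
    by_cases hSX : S ∈ X
    · rw [Set.indicator_of_mem hSX, Set.indicator_of_mem ((hX S hS).2 hSX), wtW_image f hF hp hS]
    · rw [Set.indicator_of_notMem hSX, Set.indicator_of_notMem (fun h => hSX ((hX S hS).1 h))]

end Mass

/-! ### The five masses -/

section CellMasses

variable (hf : Set.InjOn f ↑U) {D K : Finset (Sym2 V)} (hE : ∀ e ∈ D ∪ K, ∀ v ∈ e, v ∈ U)
include hf hE

omit [DecidableEq W] in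
/-- `D`'s edges lie in `U`, so `Sym2.map f` is injective on `D`. [folklore] -/
theorem injOn_D : Set.InjOn (Sym2.map f) ↑D :=
  sym2Map_injOn f hf fun e he => hE e (Finset.mem_union_left K he)

variable {a b c : V} (ha : a ∈ U) (hb : b ∈ U) (hc : c ∈ U) {p : Sym2 V → ℝ} {p' : Sym2 W → ℝ} (hp : ∀ e ∈ D, p' (Sym2.map f e) = p e)
include ha hb hc hp

/-- **Relabelling invariance of `t = P(abc)`.** [folklore] -/
theorem PrW_image_evT : PrW (D.image (Sym2.map f)) p' (evT (K.image (Sym2.map f)) (f a) (f b) (f c)) = PrW D p (evT K a b c) :=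
  PrW_image f (injOn_D f hf hE) hp fun _ hS => image_mem_evT_iff f hf hE ha hb hc hS

/-- **Relabelling invariance of `u₁ = P(ab|c)`.** [folklore] -/
theorem PrW_image_evU₁ : PrW (D.image (Sym2.map f)) p' (evU₁ (K.image (Sym2.map f)) (f a) (f b) (f c)) = PrW D p (evU₁ K a b c) :=
  PrW_image f (injOn_D f hf hE) hp fun _ hS => image_mem_evU₁_iff f hf hE ha hb hc hS

/-- **Relabelling invariance of `u₂ = P(ac|b)`.** [folklore] -/
theorem PrW_image_evU₂ : PrW (D.image (Sym2.map f)) p' (evU₂ (K.image (Sym2.map f)) (f a) (f b) (f c)) = PrW D p (evU₂ K a b c) :=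
  PrW_image f (injOn_D f hf hE) hp fun _ hS => image_mem_evU₂_iff f hf hE ha hb hc hS

/-- **Relabelling invariance of `u₃ = P(bc|a)`.** [folklore] -/
theorem PrW_image_evU₃ : PrW (D.image (Sym2.map f)) p' (evU₃ (K.image (Sym2.map f)) (f a) (f b) (f c)) = PrW D p (evU₃ K a b c) :=
  PrW_image f (injOn_D f hf hE) hp fun _ hS => image_mem_evU₃_iff f hf hE ha hb hc hS

/-- **Relabelling invariance of `q = P(a|b|c)`.** [folklore] -/
theorem PrW_image_evQ : PrW (D.image (Sym2.map f)) p' (evQ (K.image (Sym2.map f)) (f a) (f b) (f c)) = PrW D p (evQ K a b c) :=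
  PrW_image f (injOn_D f hf hE) hp fun _ hS => image_mem_evQ_iff f hf hE ha hb hc hS

end CellMasses

end VertexRelabel

end Summit.CriticalPhenomena.PercolationContinuityZ3.Theorems

end
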